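import Mathlib
import HarnessLib.Audit
import Summits.PneNP.PneNP.Theorems.PstarGateCaseTPair
import Summits.PneNP.PneNP.Theorems.PstarForcing

/-!
# One GATED chord, CASE T: the exceptional pair is impossible — every other chord is COUPLED (E2; prover-1 g19)

FRONTIER range-avoidance ladder, rung F-N3 (`stmt-PneNP-19007`), cell `pnp-ideate` (`PstarGateNodesX`, nodes N3/N4); restricted-model proof
complexity — nothing here bears on `P` versus `NP`.

`PstarGateCaseTPair.caseT_pair_budget` leaves, besides the coupled case (a private shared edge), the EXCEPTIONAL pair: no edge of
`U = D e ∪ D e'` through `u`, `#U ≤ 3`, no member of `X = U ∪ {e, e', g₀}`-private edge on `D e ∩ D e'`.  Then `#U = 3`, every edge of `U` has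
an AND slot read by another edge of `U` (touch lemma / non-privacy; chords and the gate cannot hold tree-edge AND variables), and the boundary
count on `X` (`e ≤ 1`, `e' ≤ 2`, `g₀ ≤ 3`, hence the three tree edges must pay `≥ 3`, i.e. exactly one private slot each) forces the three shared
variables to coincide: `U` is an AND-star with centre `v`.  But then `Q_{D e} = x_v · L` is a product of two linear forms, contradicting rank
four (`PstarForcing.not_rank_four_of_mul`, `rank_four_of_wf`):

* `caseT_coupled` — **in CASE T every other chord satisfies `u_{e'} = u_e + 1` on the gate chamber.**
-/

set_option linter.dupNamespace false -- `Summit.PneNP.PneNP.…`: summit = sub-problem name (D-0017 single-conjunct layout)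

open Finset Module Literature.Computability.Complexity
open Summit.PneNP.PneNP.Theorems.PstarTyped (Typed)
open Summit.PneNP.PneNP.Theorems.PstarSALevel (varSet bdry BoundaryExpanding SimpleOverlap)
open Summit.PneNP.PneNP.Theorems.PstarGapLinearised (andPair andPair_subset_varSet)
open Summit.PneNP.PneNP.Theorems.PstarChordEndgameTools (mem_andPair_iff)
open Summit.PneNP.PneNP.Theorems.PstarCentreFree (vars_mem_varSet)
open Summit.PneNP.PneNP.Theorems.PstarCubeIdeals (IsAffineFn)
open Summit.PneNP.PneNP.Theorems.PstarProductRank (qform)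
open Summit.PneNP.PneNP.Theorems.PstarForcing (not_rank_four_of_mul)
open Summit.PneNP.PneNP.Theorems.PstarReadSumset (V2)
open Summit.PneNP.PneNP.Theorems.PstarChordSystem (ChordSystem)
open Summit.PneNP.PneNP.Theorems.PstarChordBridgeTools (privs coef vars_mem_privs not_mem_privs_of_mem_sdiff)
open Summit.PneNP.PneNP.Theorems.PstarChordBridge (BridgeData sys)
open Summit.PneNP.PneNP.Theorems.PstarChordBridgeForcing (qform_add' rank_four_of_wf)
open Summit.PneNP.PneNP.Theorems.PstarChordBridgeFundamental (two_le_card_of_even eq_of_fundamental_eq)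
open Summit.PneNP.PneNP.Theorems.PstarNorCoreTools (not_mem_bdry_of_two card_varSet_inter_bdry_le card_bdry_le_sum)
open Summit.PneNP.PneNP.Theorems.PstarNorUnitBridge (xor_not_mem_bdry_of_even)
open Summit.PneNP.PneNP.Theorems.PstarGateBridge (GateHyp)
open Summit.PneNP.PneNP.Theorems.PstarGateCasePNorHolders (not_mem_bdry_sup card_three_slots)
open Summit.PneNP.PneNP.Theorems.PstarGateNodes (GateData)
open Summit.PneNP.PneNP.Theorems.PstarGateNodesX (GateDataX)
open Summit.PneNP.PneNP.Theorems.PstarGateCaseTTouch (caseT_touch caseT_touch')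
open Summit.PneNP.PneNP.Theorems.PstarGateCaseTPair (caseT_pair_budget caseT_pair_coupled)

namespace Summit.PneNP.PneNP.Theorems.PstarGateCaseTPairExc

variable {n m : ℕ}

/-- **Every other chord is coupled to the gated one on the gate chamber** (CASE T). -/
theorem caseT_coupled (I : LocalMap 4 n m) (hI : I.IsPure xorAndPred) (hT : Typed I) (hS : SimpleOverlap I) {r₀ : ℕ}
    (hB : BoundaryExpanding r₀ I) {B : BridgeData n m} {e g₀ : Fin m} {u : Fin n} {κ₀ : ZMod 2} (hD : GateDataX I r₀ B e g₀ u κ₀)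
    {mv : V2} (hmvT : mv = (0, 1) ∨ mv = (1, 1)) {e' : Fin m} (he' : e' ∈ B.N) (hne : e' ≠ e)
    (hP : ∀ a, ((sys I B).ρ e' a = 0 ∨ (sys I B).ρ e' a = mv) ∧ ((sys I B).ρ' e' a = 0 ∨ (sys I B).ρ' e' a = mv))
    (hread : ∀ a, (sys I B).ρ e' a ≠ 0 ∨ (sys I B).ρ' e' a ≠ 0) :
    ∀ x : Fin n → ZMod 2, x u = κ₀ + 1 → (sys I B).u e' x = (sys I B).u e x + 1 := by
  classical
  obtain ⟨hXc, hW, hr, hd₁, -, -, -, -, hG, hg₀, hgv, -⟩ := id hD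
  have he : e ∈ B.N := hG.1
  have heJ : e ∈ B.J₀ := hW.hN he
  have he'J : e' ∈ B.J₀ := hW.hN he'
  have hg₀J : g₀ ∉ B.J₀ := fun h => disjoint_left.1 hd₁ hg₀ h
  have hJr : B.J₀.card ≤ r₀ := (card_le_card (subset_union_left.trans subset_union_left)).trans hr
  have heD : e ∉ B.D e := fun h => (mem_sdiff.1 (hW.hD e he h)).2 he
  have he'D' : e' ∉ B.D e' := fun h => (mem_sdiff.1 (hW.hD e' he' h)).2 he'
  set U := B.D e ∪ B.D e' with hUdef
  have hUF : U ⊆ B.J₀ \ B.N := union_subset (hW.hD e he) (hW.hD e' he')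
  have hUJ : U ⊆ B.J₀ := hUF.trans sdiff_subset
  set X : Finset (Fin m) := insert g₀ (insert e (insert e' U)) with hXdef
  have hXU : ∀ j ∈ U, j ∈ X := fun j hj => mem_insert_of_mem (mem_insert_of_mem (mem_insert_of_mem hj))
  have heU : e ∉ U := fun h => (mem_sdiff.1 (hUF h)).2 he
  have he'U : e' ∉ U := fun h => (mem_sdiff.1 (hUF h)).2 he'
  have he'X' : e ∉ insert e' U := by rw [mem_insert, not_or]; exact ⟨Ne.symm hne, heU⟩
  have hg₀X' : g₀ ∉ insert e (insert e' U) := by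
    rw [mem_insert, mem_insert, not_or, not_or]; exact ⟨fun h => hg₀J (h ▸ heJ), fun h => hg₀J (h ▸ he'J), fun h => hg₀J (hUJ h)⟩
  have hg₀X : g₀ ∈ X := mem_insert_self _ _
  have heX : e ∈ X := mem_insert_of_mem (mem_insert_self _ _)
  have he'X : e' ∈ X := mem_insert_of_mem (mem_insert_of_mem (mem_insert_self _ _))
  have hu_g₀ : u ∈ varSet I g₀ := by rcases hgv with ⟨-, h⟩ | ⟨h, -⟩ <;> exact h ▸ vars_mem_varSet I g₀ _
  have hp_g₀ : I.vars e 2 ∈ varSet I g₀ := by rcases hgv with ⟨h, -⟩ | ⟨-, h⟩ <;> exact h ▸ vars_mem_varSet I g₀ _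
  obtain ⟨Pv, hPv, hpriv, hPvin, hwith, hwo⟩ := caseT_pair_budget I hI hT hS hB hD hmvT he' hne hP hread
  by_cases hPvne : Pv.Nonempty
  · -- a private shared edge couples the two cycles
    obtain ⟨π, hπ⟩ := hPvne
    obtain ⟨hπDe, hπDe'⟩ := mem_inter.1 (hPv hπ)
    have hπJ : π ∈ B.J₀ := (mem_sdiff.1 (hW.hD e he hπDe)).1
    have hgπ := hpriv π hπ g₀ (mem_insert_self _ _) (fun h => hg₀J (h ▸ hπJ))
    have h2u : I.vars π 2 ≠ u := fun h => hgπ.1 (h ▸ hu_g₀)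
    have h3u : I.vars π 3 ≠ u := fun h => hgπ.2 (h ▸ hu_g₀)
    have hpc : ∀ j ∈ B.D e, j ≠ π → I.vars π 2 ∉ andPair I j ∧ I.vars π 3 ∉ andPair I j := fun j hj hne' =>
      ⟨fun h => (hpriv π hπ j (hXU j (mem_union_left _ hj)) hne').1 (andPair_subset_varSet I j h),
       fun h => (hpriv π hπ j (hXU j (mem_union_left _ hj)) hne').2 (andPair_subset_varSet I j h)⟩
    have hpc' : ∀ j ∈ B.D e', j ≠ π → I.vars π 2 ∉ andPair I j ∧ I.vars π 3 ∉ andPair I j := fun j hj hne' =>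
      ⟨fun h => (hpriv π hπ j (hXU j (mem_union_right _ hj)) hne').1 (andPair_subset_varSet I j h),
       fun h => (hpriv π hπ j (hXU j (mem_union_right _ hj)) hne').2 (andPair_subset_varSet I j h)⟩
    exact PstarGateSharedEdge.coupled_of_private_shared I hI u (κ₀ + 1) (PstarGateCaseTTouch.caseT_force I hI hT hD hmvT he' hne hP hread)
      hπDe hπDe' h2u h3u hpc hpc'
  -- otherwise: the exceptional pair, which we refute
  exfalso
  have hPv0 : Pv = ∅ := not_nonempty_iff_eq_empty.1 hPvne
  rw [hPv0, card_empty, mul_zero, add_zero] at hwith hwo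
  have hwo' : U.card ≤ 3 := hwo
  have hwith' : (∃ j ∈ U, I.vars j 2 = u ∨ I.vars j 3 = u) → U.card ≤ 1 := hwith
  have h2De : 2 ≤ (B.D e).card := two_le_card_of_even I hI hS heD (hW.hDeven e he)
  have h2U : 2 ≤ U.card := h2De.trans (card_le_card subset_union_left)
  -- no edge of `U` passes through `u`
  have hnou : ∀ j ∈ U, I.vars j 2 ≠ u ∧ I.vars j 3 ≠ u := by
    intro j hj
    by_contra h
    rw [not_and_or, not_not, not_not] at h
    have := hwith' ⟨j, hj, h⟩; omega
  -- `#U = 3`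
  have hDne : B.D e ≠ B.D e' := by
    intro hDD
    have he'D : e' ∉ B.D e := fun h => (mem_sdiff.1 (hW.hD e he h)).2 he'
    have hev' : ∀ w, Even (PstarChordBridgeTools.xpdeg I (insert e' (B.D e)) w) := fun w => by rw [hDD]; exact hW.hDeven e' he' w
    exact hne (eq_of_fundamental_eq I hI hS heD he'D (hW.hDeven e he) hev').symm
  have hU3 : U.card = 3 := by
    have h2De' : 2 ≤ (B.D e').card := two_le_card_of_even I hI hS he'D' (hW.hDeven e' he')
    by_contra h3
    have hU2 : U.card ≤ 2 := by omega
    have hDeU : B.D e = U := eq_of_subset_of_card_le subset_union_left (by omega)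
    have hDe'U : B.D e' = U := eq_of_subset_of_card_le subset_union_right (by omega)
    exact hDne (hDeU.trans hDe'U.symm)
  -- holders of tree-edge AND variables are tree edges of `U`
  have holder : ∀ j ∈ U, ∀ s : Fin 4, 2 ≤ s.val → ∀ j' ∈ X, j' ≠ j → I.vars j s ∈ varSet I j' →
      j' ∈ U ∧ I.vars j s ∈ andPair I j' := by
    intro j hj s hs j' hj' hne' hv
    have hjF : j ∈ B.J₀ \ B.N := hUF hj
    have hnp : I.vars j s ∉ privs I B.N := not_mem_privs_of_mem_sdiff I hW.hN hW.hchord hjF s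
    unfold PstarSALevel.varSet at hv
    obtain ⟨t, -, ht⟩ := mem_image.1 hv
    have ht2 : 2 ≤ t.val := by
      by_contra hlt
      exact hT j' j t s (by omega) hs ht
    have hand : I.vars j s ∈ andPair I j' := by
      have ht23 : t = 2 ∨ t = 3 := by rcases t with ⟨t, h4⟩; simp only [Fin.ext_iff]; simp only at ht2; omega
      rcases ht23 with rfl | rfl; exact (mem_andPair_iff I j' _).2 (Or.inl ht.symm); exact (mem_andPair_iff I j' _).2 (Or.inr ht.symm)
    refine ⟨?_, hand⟩
    have hs23 : s = 2 ∨ s = 3 := by rcases s with ⟨s, h4⟩; simp only [Fin.ext_iff]; simp only at hs; omega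
    have hvu : I.vars j s ≠ u := by rcases hs23 with rfl | rfl; exact (hnou j hj).1; exact (hnou j hj).2
    rw [hXdef, mem_insert, mem_insert, mem_insert] at hj'
    rcases hj' with rfl | rfl | rfl | h
    · exfalso
      have hvp : I.vars j s ≠ I.vars e 2 := fun h => hnp (h ▸ vars_mem_privs I he (s := 2) (by decide))
      rcases (mem_andPair_iff I _ _).1 hand with h | h <;> rcases hgv with ⟨h2, h3⟩ | ⟨h2, h3⟩
      exacts [hvp (h.trans h2), hvu (h.trans h2), hvu (h.trans h3), hvp (h.trans h3)]
    · exfalso; rcases (mem_andPair_iff I _ _).1 hand with h | h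
      exacts [hnp (h ▸ vars_mem_privs I he (s := 2) (by decide)), hnp (h ▸ vars_mem_privs I he (s := 3) (by decide))]
    · exfalso; rcases (mem_andPair_iff I _ _).1 hand with h | h
      exacts [hnp (h ▸ vars_mem_privs I he' (s := 2) (by decide)), hnp (h ▸ vars_mem_privs I he' (s := 3) (by decide))]
    · exact h
  -- every edge of `U` has an AND slot held by another edge of `U`
  have hsh : ∀ j ∈ U, ∃ s : Fin 4, 2 ≤ s.val ∧ ∃ j' ∈ X, j' ≠ j ∧ I.vars j s ∈ varSet I j' := by
    intro j hj
    by_contra hno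
    push Not at hno
    have hprivj : ∀ j' ∈ X, j' ≠ j → I.vars j 2 ∉ varSet I j' ∧ I.vars j 3 ∉ varSet I j' :=
      fun j' hj' hne' => ⟨hno 2 (by decide) j' hj' hne', hno 3 (by decide) j' hj' hne'⟩
    have hout : ∀ D ⊆ U, j ∉ D → I.vars j 2 ∉ D.biUnion (andPair I) ∧ I.vars j 3 ∉ D.biUnion (andPair I) := by
      intro D hDU hjD
      constructor <;> intro h <;> obtain ⟨j', hj', hv⟩ := mem_biUnion.1 h
      · exact (hprivj j' (hXU j' (hDU hj')) (fun h' => hjD (h' ▸ hj'))).1 (andPair_subset_varSet I j' hv)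
      · exact (hprivj j' (hXU j' (hDU hj')) (fun h' => hjD (h' ▸ hj'))).2 (andPair_subset_varSet I j' hv)
    by_cases hjDe : j ∈ B.D e <;> by_cases hjDe' : j ∈ B.D e'
    · have hjPv := hPvin j (mem_inter.2 ⟨hjDe, hjDe'⟩) hprivj
      rw [hPv0] at hjPv
      exact absurd hjPv (Finset.notMem_empty _)
    · exact caseT_touch I hI hT hS hD hmvT he' hne hP hread hjDe (hnou j hj).1 (hnou j hj).2
        (hout _ subset_union_right hjDe').1 (hout _ subset_union_right hjDe').2
    · exact caseT_touch' I hI hT hS hD hmvT he' hne hP hread hjDe' (hnou j hj).1 (hnou j hj).2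
        (hout _ subset_union_left hjDe).1 (hout _ subset_union_left hjDe).2
    · rcases mem_union.1 hj with h | h; exact hjDe h; exact hjDe' h
  -- XOR slots of the two cycles are inner in `X`
  have hDsubX : insert e (B.D e) ⊆ X := insert_subset heX fun j hj => hXU j (mem_union_left _ hj)
  have hD'subX : insert e' (B.D e') ⊆ X := insert_subset he'X fun j hj => hXU j (mem_union_right _ hj)
  have hxorU : ∀ j ∈ U, ∀ s : Fin 4, s.val < 2 → I.vars j s ∉ bdry I X := by
    intro j hj s hs
    rcases mem_union.1 hj with h | h
    · exact not_mem_bdry_sup I hDsubX (mem_insert_of_mem h) (vars_mem_varSet I j s)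
        (xor_not_mem_bdry_of_even I hI (hW.hDeven e he) j (mem_insert_of_mem h) s hs)
    · exact not_mem_bdry_sup I hD'subX (mem_insert_of_mem h) (vars_mem_varSet I j s)
        (xor_not_mem_bdry_of_even I hI (hW.hDeven e' he') j (mem_insert_of_mem h) s hs)
  have hxore : ∀ s : Fin 4, s.val < 2 → I.vars e s ∉ bdry I X := fun s hs =>
    not_mem_bdry_sup I hDsubX (mem_insert_self _ _) (vars_mem_varSet I e s)
      (xor_not_mem_bdry_of_even I hI (hW.hDeven e he) e (mem_insert_self _ _) s hs)
  have hxore' : ∀ s : Fin 4, s.val < 2 → I.vars e' s ∉ bdry I X := fun s hs =>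
    not_mem_bdry_sup I hD'subX (mem_insert_self _ _) (vars_mem_varSet I e' s)
      (xor_not_mem_bdry_of_even I hI (hW.hDeven e' he') e' (mem_insert_self _ _) s hs)
  -- no edge of `U` has BOTH AND slots held (else the boundary count on `X` fails)
  have hX6 : X.card = 6 := by
    rw [hXdef, card_insert_of_notMem hg₀X', card_insert_of_notMem he'X', card_insert_of_notMem he'U, hU3]
  have hXr : X.card ≤ r₀ := by
    refine (card_le_card ?_).trans hr
    exact insert_subset (mem_union_left _ (mem_union_right _ hg₀))
      (insert_subset (mem_union_left _ (mem_union_left _ heJ)) (insert_subset (mem_union_left _ (mem_union_left _ he'J))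
        (hUJ.trans (subset_union_left.trans subset_union_left))))
  have hexp := hB X hXr
  rw [hX6] at hexp
  have hone : ∀ j₀ ∈ U, ¬ ((∃ j' ∈ X, j' ≠ j₀ ∧ I.vars j₀ 2 ∈ varSet I j') ∧ (∃ j' ∈ X, j' ≠ j₀ ∧ I.vars j₀ 3 ∈ varSet I j')) := by
    intro j₀ hj₀ hboth
    obtain ⟨⟨k2, hk2, hne2, hv2⟩, ⟨k3, hk3, hne3, hv3⟩⟩ := hboth
    let q : Fin m → ℕ := fun k => if k = g₀ then 3 else if k = e' then 2 else if k = j₀ then 0 else 1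
    have hq : ∀ k ∈ X, (varSet I k ∩ bdry I X).card ≤ q k := by
      intro k hk
      by_cases hkg₀ : k = g₀
      · subst hkg₀
        simp only [q, if_true]
        obtain ⟨s, -, hps⟩ : ∃ s : Fin 4, 2 ≤ s.val ∧ I.vars k s = I.vars e 2 := by
          rcases hgv with ⟨h2, -⟩ | ⟨-, h3⟩; exact ⟨2, by decide, h2⟩; exact ⟨3, by decide, h3⟩
        have h := card_varSet_inter_bdry_le I X k {s} (fun s' hs' => by
          rw [mem_singleton] at hs'
          subst hs'
          exact not_mem_bdry_of_two I hk heX (fun h => hg₀J (h ▸ heJ)) (vars_mem_varSet I k s') (hps ▸ vars_mem_varSet I e 2))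
        rw [card_singleton] at h; exact h
      have hkg₀' : k ≠ g₀ := hkg₀
      by_cases hke' : k = e'
      · subst hke'
        simp only [q, if_neg hkg₀', if_true]
        have h := card_varSet_inter_bdry_le I X k {0, 1} (fun s hs => by
          simp only [mem_insert, mem_singleton] at hs
          rcases hs with rfl | rfl
          · exact hxore' 0 (by decide)
          · exact hxore' 1 (by decide))
        rw [show ({0, 1} : Finset (Fin 4)).card = 2 by decide] at h; exact h
      by_cases hke : k = e
      · subst hke
        have hkj₀ : k ≠ j₀ := fun h => (mem_sdiff.1 (hUF (h ▸ hj₀))).2 he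
        have hqk : q k = 1 := by
          show (if k = g₀ then 3 else if k = e' then 2 else if k = j₀ then 0 else 1) = 1
          rw [if_neg hkg₀', if_neg hke', if_neg hkj₀]
        rw [hqk]
        have h := card_varSet_inter_bdry_le I X k {0, 1, 2} (fun s hs => by
          simp only [mem_insert, mem_singleton] at hs
          rcases hs with rfl | rfl | rfl
          · exact hxore 0 (by decide)
          · exact hxore 1 (by decide)
          · exact not_mem_bdry_of_two I hk hg₀X (fun h => hg₀J (h.symm ▸ heJ)) (vars_mem_varSet I k 2) hp_g₀)
        rw [show ({0, 1, 2} : Finset (Fin 4)).card = 3 by decide] at h; exact h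
      have hkU : k ∈ U := by
        rw [hXdef, mem_insert, mem_insert, mem_insert] at hk
        rcases hk with h | h | h | h; exacts [absurd h hkg₀', absurd h hke, absurd h hke', h]
      by_cases hkj₀ : k = j₀
      · subst hkj₀
        have hqk : q k = 0 := by
          show (if k = g₀ then 3 else if k = e' then 2 else if k = k then 0 else 1) = 0
          rw [if_neg hkg₀', if_neg hke', if_pos rfl]
        rw [hqk]
        have h := card_varSet_inter_bdry_le I X k {0, 1, 2, 3} (fun s hs => by
          simp only [mem_insert, mem_singleton] at hs
          rcases hs with rfl | rfl | rfl | rfl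
          · exact hxorU k hkU 0 (by decide)
          · exact hxorU k hkU 1 (by decide)
          · exact not_mem_bdry_of_two I hk hk2 (Ne.symm hne2) (vars_mem_varSet I k 2) hv2
          · exact not_mem_bdry_of_two I hk hk3 (Ne.symm hne3) (vars_mem_varSet I k 3) hv3)
        rw [show ({0, 1, 2, 3} : Finset (Fin 4)).card = 4 by decide] at h; exact h
      · have hqk : q k = 1 := by
          show (if k = g₀ then 3 else if k = e' then 2 else if k = j₀ then 0 else 1) = 1
          rw [if_neg hkg₀', if_neg hke', if_neg hkj₀]
        rw [hqk]
        obtain ⟨s, hs2, k', hk', hne', hv⟩ := hsh k hkU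
        have h := card_varSet_inter_bdry_le I X k {0, 1, s} (fun s' hs' => by
          simp only [mem_insert, mem_singleton] at hs'
          rcases hs' with rfl | rfl | rfl
          · exact hxorU k hkU 0 (by decide)
          · exact hxorU k hkU 1 (by decide)
          · exact not_mem_bdry_of_two I hk hk' (Ne.symm hne') (vars_mem_varSet I k s') hv)
        rw [card_three_slots hs2] at h; exact h
    have hbd := card_bdry_le_sum I X q hq
    -- the sum is `3 + 1 + 2 + 0 + (#U - 1) = 8`
    have hg₀e : e ≠ g₀ := fun h => hg₀J (h ▸ heJ)
    have hg₀e' : e' ≠ g₀ := fun h => hg₀J (h ▸ he'J)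
    have hej₀ : e ≠ j₀ := fun h => heU (h ▸ hj₀)
    have he'j₀ : e' ≠ j₀ := fun h => he'U (h ▸ hj₀)
    have hsumU : ∑ k ∈ U, q k = U.card - 1 := by
      rw [← add_sum_erase U q hj₀]
      have hj₀g₀ : j₀ ≠ g₀ := fun h => hg₀J (h ▸ hUJ hj₀)
      have h0 : q j₀ = 0 := by
        show (if j₀ = g₀ then 3 else if j₀ = e' then 2 else if j₀ = j₀ then 0 else 1) = 0
        rw [if_neg hj₀g₀, if_neg (Ne.symm he'j₀), if_pos rfl]
      have hrest : ∑ k ∈ U.erase j₀, q k = (U.erase j₀).card := by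
        rw [card_eq_sum_ones]
        refine sum_congr rfl fun k hk => ?_
        obtain ⟨hkj, hkU⟩ := mem_erase.1 hk
        have hkg₀ : k ≠ g₀ := fun h => hg₀J (h ▸ hUJ hkU)
        have hke' : k ≠ e' := fun h => he'U (h ▸ hkU)
        show (if k = g₀ then 3 else if k = e' then 2 else if k = j₀ then 0 else 1) = 1
        rw [if_neg hkg₀, if_neg hke', if_neg hkj]
      rw [h0, hrest, card_erase_of_mem hj₀, zero_add]
    have hsumX : ∑ k ∈ X, q k = 3 + (1 + (2 + (U.card - 1))) := by
      rw [hXdef, sum_insert hg₀X', sum_insert he'X', sum_insert he'U, hsumU]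
      have hqg₀ : q g₀ = 3 := by
        show (if g₀ = g₀ then 3 else if g₀ = e' then 2 else if g₀ = j₀ then 0 else 1) = 3
        rw [if_pos rfl]
      have hqe : q e = 1 := by
        show (if e = g₀ then 3 else if e = e' then 2 else if e = j₀ then 0 else 1) = 1
        rw [if_neg hg₀e, if_neg (Ne.symm hne), if_neg hej₀]
      have hqe' : q e' = 2 := by
        show (if e' = g₀ then 3 else if e' = e' then 2 else if e' = j₀ then 0 else 1) = 2
        rw [if_neg hg₀e', if_pos rfl]
      rw [hqg₀, hqe, hqe']
    rw [hsumX, hU3] at hbd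
    omega
  -- the three edges of `U` form an AND-star
  obtain ⟨j₁, hj₁U⟩ : U.Nonempty := card_pos.1 (by omega)
  -- "slot `s` of `j` is held": some other member of `X` reads `vars j s`
  -- uniqueness of the held slot (`hone`) as: two held slots carry the same variable
  have huniq : ∀ j ∈ U, ∀ s t : Fin 4, 2 ≤ s.val → 2 ≤ t.val →
      (∃ j' ∈ X, j' ≠ j ∧ I.vars j s ∈ varSet I j') → (∃ j' ∈ X, j' ≠ j ∧ I.vars j t ∈ varSet I j') → I.vars j s = I.vars j t := by
    intro j hj s t hs ht hhs hht
    have hs23 : s = 2 ∨ s = 3 := by rcases s with ⟨s, h4⟩; simp only [Fin.ext_iff]; simp only at hs; omega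
    have ht23 : t = 2 ∨ t = 3 := by rcases t with ⟨t, h4⟩; simp only [Fin.ext_iff]; simp only at ht; omega
    rcases hs23 with rfl | rfl <;> rcases ht23 with rfl | rfl
    exacts [rfl, absurd ⟨hhs, hht⟩ (hone j hj), absurd ⟨hht, hhs⟩ (hone j hj), rfl]
  -- the shared variable `v` of `j₁`
  obtain ⟨s₁, hs₁, k₁, hk₁X, hk₁ne, hv₁⟩ := hsh j₁ hj₁U
  set v := I.vars j₁ s₁ with hvdef
  obtain ⟨hk₁U, hvk₁⟩ := holder j₁ hj₁U s₁ hs₁ k₁ hk₁X hk₁ne hv₁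
  -- `v` lies in the AND pair of every edge of `U`
  have hvall : ∀ j ∈ U, v ∈ andPair I j := by
    -- membership for `j₁` and `k₁`
    have hvj₁ : v ∈ andPair I j₁ := by
      have hs23 : s₁ = 2 ∨ s₁ = 3 := by rcases s₁ with ⟨s, h4⟩; simp only [Fin.ext_iff]; simp only at hs₁; omega
      rcases hs23 with h | h
      exacts [(mem_andPair_iff I j₁ v).2 (Or.inl (by rw [hvdef, h])), (mem_andPair_iff I j₁ v).2 (Or.inr (by rw [hvdef, h]))]
    -- for any edge `j` of `U` holding... general step: if `j ≠ j'` both in `U`, `v ∈ andPair j'`, `v` held in `j'` by someone,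
    -- and `j`'s shared variable is held by `j'`, then it equals `v`.
    have step : ∀ j ∈ U, ∀ j' ∈ U, j' ≠ j → v ∈ andPair I j' → (∃ j'' ∈ X, j'' ≠ j' ∧ v ∈ varSet I j'') →
        ∀ s : Fin 4, 2 ≤ s.val → I.vars j s ∈ andPair I j' → I.vars j s = v := by
      intro j hj j' hj' hjj' hvj' hvheld s hs hw
      -- `w := vars j s` sits in slot `r` of `j'`, `v` in slot `r'`; both held ⟹ equal variables
      obtain ⟨r, hr, hwr⟩ : ∃ r : Fin 4, 2 ≤ r.val ∧ I.vars j' r = I.vars j s := by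
        rcases (mem_andPair_iff I j' _).1 hw with h | h; exact ⟨2, by decide, h.symm⟩; exact ⟨3, by decide, h.symm⟩
      obtain ⟨r', hr', hvr'⟩ : ∃ r' : Fin 4, 2 ≤ r'.val ∧ I.vars j' r' = v := by
        rcases (mem_andPair_iff I j' _).1 hvj' with h | h; exact ⟨2, by decide, h.symm⟩; exact ⟨3, by decide, h.symm⟩
      have hheld_r : ∃ j'' ∈ X, j'' ≠ j' ∧ I.vars j' r ∈ varSet I j'' :=
        ⟨j, hXU j hj, Ne.symm hjj', by rw [hwr]; exact vars_mem_varSet I j s⟩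
      have hheld_r' : ∃ j'' ∈ X, j'' ≠ j' ∧ I.vars j' r' ∈ varSet I j'' := by rw [hvr']; exact hvheld
      have h := huniq j' hj' r r' hr hr' hheld_r hheld_r'
      rwa [hwr, hvr'] at h
    -- `v` is held in `j₁` (by `k₁`) and in `k₁` (by `j₁`)
    have hvheld_j₁ : ∃ j'' ∈ X, j'' ≠ j₁ ∧ v ∈ varSet I j'' := ⟨k₁, hk₁X, hk₁ne, hv₁⟩
    have hvheld_k₁ : ∃ j'' ∈ X, j'' ≠ k₁ ∧ v ∈ varSet I j'' := ⟨j₁, hXU j₁ hj₁U, Ne.symm hk₁ne, by rw [hvdef]; exact vars_mem_varSet I j₁ s₁⟩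
    intro j hj
    by_cases hjj₁ : j = j₁
    · rw [hjj₁]; exact hvj₁
    by_cases hjk₁ : j = k₁
    · rw [hjk₁]; exact hvk₁
    -- the third edge: its shared variable is held by `j₁` or `k₁`, hence equals `v`
    obtain ⟨s, hs, k, hkX, hkne, hvk⟩ := hsh j hj
    obtain ⟨hkU, hwk⟩ := holder j hj s hs k hkX hkne hvk
    have hk' : k = j₁ ∨ k = k₁ := by
      -- `U = {j, j₁, k₁}`: three pairwise distinct members of a three-element set
      have hsub : ({j, j₁, k₁} : Finset (Fin m)) ⊆ U := insert_subset hj (insert_subset hj₁U (singleton_subset_iff.2 hk₁U))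
      have hcard : ({j, j₁, k₁} : Finset (Fin m)).card = 3 := by
        rw [card_insert_of_notMem, card_insert_of_notMem, card_singleton]
        · rw [mem_singleton]; exact Ne.symm hk₁ne
        · rw [mem_insert, mem_singleton, not_or]; exact ⟨hjj₁, hjk₁⟩
      have hUeq : ({j, j₁, k₁} : Finset (Fin m)) = U := eq_of_subset_of_card_le hsub (by rw [hU3, hcard])
      have hk3 : k ∈ ({j, j₁, k₁} : Finset (Fin m)) := by rw [hUeq]; exact hkU
      rw [mem_insert, mem_insert, mem_singleton] at hk3
      rcases hk3 with h | h | h; exacts [absurd h hkne, Or.inl h, Or.inr h]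
    have hws : I.vars j s = v := by
      rcases hk' with rfl | rfl
      · exact step j hj _ hj₁U (Ne.symm hjj₁) hvj₁ hvheld_j₁ s hs hwk
      · exact step j hj _ hk₁U (Ne.symm hjk₁) hvk₁ hvheld_k₁ s hs hwk
    have hs23 : s = 2 ∨ s = 3 := by rcases s with ⟨s, h4⟩; simp only [Fin.ext_iff]; simp only at hs; omega
    rcases hs23 with h | h
    exacts [(mem_andPair_iff I j v).2 (Or.inl (by rw [← hws, h])), (mem_andPair_iff I j v).2 (Or.inr (by rw [← hws, h]))]
  -- hence `Q_{D e} = x_v · L`: rank at most two, contradicting rank four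
  have hDeU : B.D e ⊆ U := subset_union_left
  let o : Fin m → Fin n := fun j => if I.vars j 2 = v then I.vars j 3 else I.vars j 2
  have hfac : ∀ x : Fin n → ZMod 2, qform (B.D e) (fun j => I.vars j 2) (fun j => I.vars j 3) x = x v * ∑ j ∈ B.D e, x (o j) := by
    intro x
    unfold qform
    rw [mul_sum]
    refine sum_congr rfl fun j hj => ?_
    have hvj := hvall j (hDeU hj)
    by_cases h2 : I.vars j 2 = v
    · simp only [o, h2, if_true]
    · have h3 : I.vars j 3 = v := by
        rcases (mem_andPair_iff I j v).1 hvj with h | h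
        · exact absurd h.symm h2
        · exact h.symm
      simp only [o, if_neg h2, h3]
      ring
  have hμ₁ : IsAffineFn (fun x : Fin n → ZMod 2 => x v) := by
    intro x w; simp only [Pi.add_apply, Pi.zero_apply, add_zero]
  have hμ₂ : IsAffineFn (fun x : Fin n → ZMod 2 => ∑ j ∈ B.D e, x (o j)) := by
    intro x w
    simp only [Pi.add_apply, Pi.zero_apply, sum_const_zero, add_zero, sum_add_distrib]
  have hrank := rank_four_of_wf I hI hS hB hW hJr he
  exact not_rank_four_of_mul (qform_add' I (B.D e)) hμ₁ hμ₂ (κ := 0) (fun x => by rw [hfac x, add_zero]) hrank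

end Summit.PneNP.PneNP.Theorems.PstarGateCaseTPairExc
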